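import Summits.CriticalPhenomena.Ising3D.Control2DBoxCells
import Summits.CriticalPhenomena.Ising3D.Control2DL17BoxYData80
import Summits.CriticalPhenomena.Ising3D.Control2DL17BoxYData81
import Summits.CriticalPhenomena.Ising3D.Control2DL17BoxYData82
import Summits.CriticalPhenomena.Ising3D.Control2DL17BoxYData83
import Summits.CriticalPhenomena.Ising3D.Control2DL17BoxYData84
import Summits.CriticalPhenomena.Ising3D.Control2DL17BoxYData85
import Summits.CriticalPhenomena.Ising3D.Control2DL17BoxYData86
import Summits.CriticalPhenomena.Ising3D.Control2DL17BoxYData87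
import Summits.CriticalPhenomena.Ising3D.Control2DL17BoxYData88
import Summits.CriticalPhenomena.Ising3D.Control2DL17BoxYData89
import Summits.CriticalPhenomena.Ising3D.Control2DL17BoxYData90
import Summits.CriticalPhenomena.Ising3D.Control2DL17BoxYData91
import Summits.CriticalPhenomena.Ising3D.Control2DL17BoxYData92
import Summits.CriticalPhenomena.Ising3D.Control2DL17BoxYData93
import Summits.CriticalPhenomena.Ising3D.Control2DL17BoxYData94
import Summits.CriticalPhenomena.Ising3D.Control2DL17BoxYData95
import Summits.CriticalPhenomena.Ising3D.Control2DL17BoxYRegion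
import Mathlib.Tactic.IntervalCases
import Mathlib.Tactic.Linarith
import Mathlib.Tactic.NormNum
import HarnessLib

/-!
# A kind-`box` 2D γ-certificate in the kernel: `Δ_ε ∉ [977/1000, 491/500]` at `Δ_σ = 1/8` under `A2D′` (Λ = 17)
(cell `pub-ising3x`, seat controls-1 gen 22; KERNEL PATH for the 2D γ-certificates, Λ = 17 box kind — CONTROL-ONLY)

HONEST FRAMING: lottery ticket; floor = tightest certified 3D Ising CFT bounds; no exact-solution
claim without a proof. CONTROL-ONLY: `d = 2`, global blocks, `Δ_σ = 1/8` exact, the 2D axiom set `A2D′`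
(scalars of `σ × σ` in the `ε` box `∪ [2, ∞)`, stress tensor at `(2,2)` + spin-2 gap `1`, unitarity) — this
validates the kind-`box` certificate PIPELINE of the class-1 2D control on the exactly solved 2D Ising model
(`Δ_ε = 1`); nothing about `d = 3`.

**`excludedOn_2d_L17_boxY : ExcludedOn (1/8) 2 1 (Icc (977 / 1000) (491 / 500))`** from the P9(a) candidate certificate (lead g22 kit job, not an RB round) `j195171_functional_deriv2d_L17_E040_sig1o8_box0.977-0.982.json` (Λ = 17, E₀ = 40): Δ_ε ∉ [977/1000, 491/500] at Δ_σ = 1/8 under A2D′,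
with EVERY obligation re-decided in the Lean kernel: (I) `ident_boxY`, (R) by `region_of_kernelCertAuto` applied HERE to the kernel facts
`cregboxY_n0` (`Control2DL17BoxYRegion`) and `cregJboxY_ok` (`Control2DL17BoxYTable`) — no standalone `region_boxY` (gate dedup lint), cells `cells_boxY` (one integer polynomial
per spin from the literal library, Bernstein leaves). Zero grant compute. No facts, standard axioms only.

`cells_boxY`: every cell obligation of the certificate ((E) on the ε box, (C′) scalars on [2, E₀), the stress-tensor point (T), spin 2 on [3, E₀), even spins ≥ 4 on [ℓ, E₀); E₀ = 40), in the witness form `∃ N ≥ E₀` with the spin's own truncation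
order, from the kernel-decided Bernstein leaves of `Control2DL17BoxYData*` via `cell_nonneg_of_bernCheck` (leaves of the extra leaf files are decided on the GROUP-SUM form `phat…g<i>` of the cell polynomial; each such application bridges `phat… = phat…g<i>` by an inline `decide +kernel` — controls-1 g20, one gate dependency level less). No facts, standard axioms only.

ONE MODULE for the cells theorem and the assembly (controls-1 g20): every gate dependency level waits for the farm's tree build to catch
up with the freshly landed imports (measured 1–2 h per level under load, `remote:stale:…:unbuilt`), so the cells theorem below is not a
separate `…Cells` module as in the earlier replays; statements and proofs are unchanged.
controls-1 g25: the 24 inline group-sum bridges (5 distinct statements; each inline occurrence a separate kernel check) are proved ONCE as the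
in-file theorems `phatboxYs<ℓ>_eq_g<i>`; statements unchanged.
-/

namespace Summit.CriticalPhenomena.Ising3D.Control2D

open Finset Set
open Literature.MathematicalPhysics.QuantumFieldTheory.ConformalBootstrap3D

set_option maxHeartbeats 0 in
/-- Group-sum bridge (controls-1 g25: proved ONCE here; each inline occurrence was a separate ≈ 20–55 s kernel check). [folklore] -/
theorem phatboxYs0_eq_g2 : phatboxYs0 = phatboxYs0g2 := by decide +kernel

set_option maxHeartbeats 0 in
/-- Group-sum bridge (controls-1 g25: proved ONCE here; each inline occurrence was a separate ≈ 20–55 s kernel check). [folklore] -/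
theorem phatboxYs0_eq_g3 : phatboxYs0 = phatboxYs0g3 := by decide +kernel

set_option maxHeartbeats 0 in
/-- Group-sum bridge (controls-1 g25: proved ONCE here; each inline occurrence was a separate ≈ 20–55 s kernel check). [folklore] -/
theorem phatboxYs2_eq_g2 : phatboxYs2 = phatboxYs2g2 := by decide +kernel

set_option maxHeartbeats 0 in
/-- Group-sum bridge (controls-1 g25: proved ONCE here; each inline occurrence was a separate ≈ 20–55 s kernel check). [folklore] -/
theorem phatboxYs4_eq_g2 : phatboxYs4 = phatboxYs4g2 := by decide +kernel

set_option maxHeartbeats 0 in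
/-- Group-sum bridge (controls-1 g25: proved ONCE here; each inline occurrence was a separate ≈ 20–55 s kernel check). [folklore] -/
theorem phatboxYs6_eq_g2 : phatboxYs6 = phatboxYs6g2 := by decide +kernel

set_option maxHeartbeats 0 in
set_option maxRecDepth 200000 in
/-- **The cells of the certificate** (Δ_ε ∉ [977/1000, 491/500] at Δ_σ = 1/8 under A2D′; `E₀ = 40`; truncation `N = Nd + 1` per spin:
ℓ=0: 72, ℓ=2: 72, ℓ=4: 72, ℓ=6: 72, ℓ=8: 72, ℓ=10: 64, ℓ=12: 64, ℓ=14: 64, ℓ=16: 56 ; others `N = 48`). [folklore] -/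
theorem cells_boxY :
    BoxCellsN slL17.toFinset (fun p => (wtboxY p : ℝ)) (1 / 8) 2 1 (977 / 1000) (491 / 500) 40 := by
  refine ⟨?_, ?_, ?_, ?_, ?_⟩
  · intro Δ h1 h2
    refine ⟨71 + 1, by norm_num, ?_⟩
    exact cell_nonneg_of_bernAuto_trunc wtboxY slL17_nodup slL17_deg 0 71 490 (q := 2000) (a := 977) (L := 5) (by norm_num) (by norm_num) (by norm_num) (by rw [phatboxYs0_eq]; exact cellChk_boxY_s0l0) (by norm_num; linarith) (by norm_num; linarith)
  · intro Δ h1 h2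
    replace h2 := h2.le
    refine ⟨71 + 1, by norm_num, ?_⟩
    rcases le_or_gt Δ ((51 : ℝ) / 16) with hd0 | hd0
    · exact cell_nonneg_of_bernAuto_trunc wtboxY slL17_nodup slL17_deg 0 71 490 (q := 32) (a := 32) (L := 19) (by norm_num) (by norm_num) (by norm_num) (by rw [phatboxYs0_eq]; exact cellChk_boxY_s0l1) (by norm_num; linarith) (by norm_num; linarith)
    rcases le_or_gt Δ ((121 : ℝ) / 32) with hd1 | hd1
    · exact cell_nonneg_of_bernAuto_trunc wtboxY slL17_nodup slL17_deg 0 71 490 (q := 64) (a := 102) (L := 19) (by norm_num) (by norm_num) (by norm_num) (by rw [phatboxYs0_eq]; exact cellChk_boxY_s0l2) (by norm_num; linarith) (by norm_num; linarith)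
    rcases le_or_gt Δ ((261 : ℝ) / 64) with hd2 | hd2
    · exact cell_nonneg_of_bernAuto_trunc wtboxY slL17_nodup slL17_deg 0 71 490 (q := 128) (a := 242) (L := 19) (by norm_num) (by norm_num) (by norm_num) (by rw [phatboxYs0_eq]; exact cellChk_boxY_s0l3) (by norm_num; linarith) (by norm_num; linarith)
    rcases le_or_gt Δ ((541 : ℝ) / 128) with hd3 | hd3
    · exact cell_nonneg_of_bernAuto_trunc wtboxY slL17_nodup slL17_deg 0 71 490 (q := 256) (a := 522) (L := 19) (by norm_num) (by norm_num) (by norm_num) (by rw [phatboxYs0_eq]; exact cellChk_boxY_s0l4) (by norm_num; linarith) (by norm_num; linarith)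
    rcases le_or_gt Δ ((35 : ℝ) / 8) with hd4 | hd4
    · exact cell_nonneg_of_bernAuto_trunc wtboxY slL17_nodup slL17_deg 0 71 490 (q := 256) (a := 541) (L := 19) (by norm_num) (by norm_num) (by norm_num) (by rw [phatboxYs0_eq, phatboxYs0_eq_g2]; exact cellChk_boxY_s0l5) (by norm_num; linarith) (by norm_num; linarith)
    rcases le_or_gt Δ ((27 : ℝ) / 4) with hd5 | hd5
    · exact cell_nonneg_of_bernAuto_trunc wtboxY slL17_nodup slL17_deg 0 71 490 (q := 16) (a := 35) (L := 19) (by norm_num) (by norm_num) (by norm_num) (by rw [phatboxYs0_eq, phatboxYs0_eq_g2]; exact cellChk_boxY_s0l6) (by norm_num; linarith) (by norm_num; linarith)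
    rcases le_or_gt Δ ((73 : ℝ) / 8) with hd6 | hd6
    · exact cell_nonneg_of_bernAuto_trunc wtboxY slL17_nodup slL17_deg 0 71 490 (q := 16) (a := 54) (L := 19) (by norm_num) (by norm_num) (by norm_num) (by rw [phatboxYs0_eq, phatboxYs0_eq_g2]; exact cellChk_boxY_s0l7) (by norm_num; linarith) (by norm_num; linarith)
    rcases le_or_gt Δ ((603 : ℝ) / 64) with hd7 | hd7
    · exact cell_nonneg_of_bernAuto_trunc wtboxY slL17_nodup slL17_deg 0 71 490 (q := 128) (a := 584) (L := 19) (by norm_num) (by norm_num) (by norm_num) (by rw [phatboxYs0_eq, phatboxYs0_eq_g2]; exact cellChk_boxY_s0l8) (by norm_num; linarith) (by norm_num; linarith)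
    rcases le_or_gt Δ ((1225 : ℝ) / 128) with hd8 | hd8
    · exact cell_nonneg_of_bernAuto_trunc wtboxY slL17_nodup slL17_deg 0 71 480 (q := 256) (a := 1206) (L := 19) (by norm_num) (by norm_num) (by norm_num) (by rw [phatboxYs0_eq, phatboxYs0_eq_g2]; exact cellChk_boxY_s0l9) (by norm_num; linarith) (by norm_num; linarith)
    rcases le_or_gt Δ ((2469 : ℝ) / 256) with hd9 | hd9
    · exact cell_nonneg_of_bernAuto_trunc wtboxY slL17_nodup slL17_deg 0 71 480 (q := 512) (a := 2450) (L := 19) (by norm_num) (by norm_num) (by norm_num) (by rw [phatboxYs0_eq, phatboxYs0_eq_g2]; exact cellChk_boxY_s0l10) (by norm_num; linarith) (by norm_num; linarith)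
    rcases le_or_gt Δ ((4957 : ℝ) / 512) with hd10 | hd10
    · exact cell_nonneg_of_bernAuto_trunc wtboxY slL17_nodup slL17_deg 0 71 470 (q := 1024) (a := 4938) (L := 19) (by norm_num) (by norm_num) (by norm_num) (by rw [phatboxYs0_eq, phatboxYs0_eq_g2]; exact cellChk_boxY_s0l11) (by norm_num; linarith) (by norm_num; linarith)
    rcases le_or_gt Δ ((311 : ℝ) / 32) with hd11 | hd11
    · exact cell_nonneg_of_bernAuto_trunc wtboxY slL17_nodup slL17_deg 0 71 480 (q := 1024) (a := 4957) (L := 19) (by norm_num) (by norm_num) (by norm_num) (by rw [phatboxYs0_eq, phatboxYs0_eq_g3]; exact cellChk_boxY_s0l12) (by norm_num; linarith) (by norm_num; linarith)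
    rcases le_or_gt Δ ((165 : ℝ) / 16) with hd12 | hd12
    · exact cell_nonneg_of_bernAuto_trunc wtboxY slL17_nodup slL17_deg 0 71 480 (q := 64) (a := 311) (L := 19) (by norm_num) (by norm_num) (by norm_num) (by rw [phatboxYs0_eq, phatboxYs0_eq_g3]; exact cellChk_boxY_s0l13) (by norm_num; linarith) (by norm_num; linarith)
    rcases le_or_gt Δ ((23 : ℝ) / 2) with hd13 | hd13
    · exact cell_nonneg_of_bernAuto_trunc wtboxY slL17_nodup slL17_deg 0 71 490 (q := 32) (a := 165) (L := 19) (by norm_num) (by norm_num) (by norm_num) (by rw [phatboxYs0_eq, phatboxYs0_eq_g3]; exact cellChk_boxY_s0l14) (by norm_num; linarith) (by norm_num; linarith)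
    rcases le_or_gt Δ (21 : ℝ) with hd14 | hd14
    · exact cell_nonneg_of_bernAuto_trunc wtboxY slL17_nodup slL17_deg 0 71 490 (q := 4) (a := 23) (L := 19) (by norm_num) (by norm_num) (by norm_num) (by rw [phatboxYs0_eq, phatboxYs0_eq_g3]; exact cellChk_boxY_s0l15) (by norm_num; linarith) (by norm_num; linarith)
    exact cell_nonneg_of_bernAuto_trunc wtboxY slL17_nodup slL17_deg 0 71 490 (q := 2) (a := 21) (L := 19) (by norm_num) (by norm_num) (by norm_num) (by rw [phatboxYs0_eq, phatboxYs0_eq_g3]; exact cellChk_boxY_s0l16) (by norm_num; linarith) (by norm_num; linarith)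
  · refine ⟨71 + 1, by norm_num, ?_⟩
    exact cell_nonneg_of_bernAuto_trunc wtboxY slL17_nodup slL17_deg 2 71 497 (q := 1) (a := 0) (L := 0) (by norm_num) (by norm_num) (by norm_num) (by rw [phatboxYs2_eq]; exact cellChk_boxY_s2l0) (by norm_num) (by norm_num)
  · intro Δ h1 h2
    replace h1 : (3 : ℝ) ≤ Δ := by linarith
    replace h2 := h2.le
    refine ⟨71 + 1, by norm_num, ?_⟩
    rcases le_or_gt Δ ((85 : ℝ) / 16) with hd0 | hd0
    · exact cell_nonneg_of_bernAuto_trunc wtboxY slL17_nodup slL17_deg 2 71 497 (q := 32) (a := 16) (L := 37) (by norm_num) (by norm_num) (by norm_num) (by rw [phatboxYs2_eq]; exact cellChk_boxY_s2l1) (by norm_num; linarith) (by norm_num; linarith)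
    rcases le_or_gt Δ ((377 : ℝ) / 64) with hd1 | hd1
    · exact cell_nonneg_of_bernAuto_trunc wtboxY slL17_nodup slL17_deg 2 71 497 (q := 128) (a := 212) (L := 37) (by norm_num) (by norm_num) (by norm_num) (by rw [phatboxYs2_eq]; exact cellChk_boxY_s2l2) (by norm_num; linarith) (by norm_num; linarith)
    rcases le_or_gt Δ ((791 : ℝ) / 128) with hd2 | hd2
    · exact cell_nonneg_of_bernAuto_trunc wtboxY slL17_nodup slL17_deg 2 71 497 (q := 256) (a := 498) (L := 37) (by norm_num) (by norm_num) (by norm_num) (by rw [phatboxYs2_eq]; exact cellChk_boxY_s2l3) (by norm_num; linarith) (by norm_num; linarith)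
    rcases le_or_gt Δ ((207 : ℝ) / 32) with hd3 | hd3
    · exact cell_nonneg_of_bernAuto_trunc wtboxY slL17_nodup slL17_deg 2 71 497 (q := 256) (a := 535) (L := 37) (by norm_num) (by norm_num) (by norm_num) (by rw [phatboxYs2_eq]; exact cellChk_boxY_s2l4) (by norm_num; linarith) (by norm_num; linarith)
    rcases le_or_gt Δ ((61 : ℝ) / 8) with hd4 | hd4
    · exact cell_nonneg_of_bernAuto_trunc wtboxY slL17_nodup slL17_deg 2 71 497 (q := 64) (a := 143) (L := 37) (by norm_num) (by norm_num) (by norm_num) (by rw [phatboxYs2_eq, phatboxYs2_eq_g2]; exact cellChk_boxY_s2l5) (by norm_num; linarith) (by norm_num; linarith)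
    rcases le_or_gt Δ ((49 : ℝ) / 4) with hd5 | hd5
    · exact cell_nonneg_of_bernAuto_trunc wtboxY slL17_nodup slL17_deg 2 71 497 (q := 16) (a := 45) (L := 37) (by norm_num) (by norm_num) (by norm_num) (by rw [phatboxYs2_eq, phatboxYs2_eq_g2]; exact cellChk_boxY_s2l6) (by norm_num; linarith) (by norm_num; linarith)
    rcases le_or_gt Δ ((43 : ℝ) / 2) with hd6 | hd6
    · exact cell_nonneg_of_bernAuto_trunc wtboxY slL17_nodup slL17_deg 2 71 497 (q := 8) (a := 41) (L := 37) (by norm_num) (by norm_num) (by norm_num) (by rw [phatboxYs2_eq, phatboxYs2_eq_g2]; exact cellChk_boxY_s2l7) (by norm_num; linarith) (by norm_num; linarith)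
    exact cell_nonneg_of_bernAuto_trunc wtboxY slL17_nodup slL17_deg 2 71 497 (q := 4) (a := 39) (L := 37) (by norm_num) (by norm_num) (by norm_num) (by rw [phatboxYs2_eq, phatboxYs2_eq_g2]; exact cellChk_boxY_s2l8) (by norm_num; linarith) (by norm_num; linarith)
  · intro ℓ hℓ hℓ0 hℓ2 Δ hℓΔ hΔ
    have hℓR : (ℓ : ℝ) < 40 := lt_of_le_of_lt hℓΔ hΔ
    have hℓE : ℓ < 40 := by exact_mod_cast hℓR
    replace h2 := hΔ.le
    interval_cases ℓ
    · exact absurd rfl hℓ0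
    · exact absurd hℓ (by decide)
    · exact absurd rfl hℓ2
    · exact absurd hℓ (by decide)
    · have h1 : (4 : ℝ) ≤ Δ := by exact_mod_cast hℓΔ
      refine ⟨71 + 1, by norm_num, ?_⟩
      rcases le_or_gt Δ ((41 : ℝ) / 8) with hd0 | hd0
      · exact cell_nonneg_of_bernAuto_trunc wtboxY slL17_nodup slL17_deg 4 71 502 (q := 16) (a := 0) (L := 9) (by norm_num) (by norm_num) (by norm_num) (by rw [phatboxYs4_eq]; exact cellChk_boxY_s4l0) (by norm_num; linarith) (by norm_num; linarith)
      rcases le_or_gt Δ ((25 : ℝ) / 4) with hd1 | hd1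
      · exact cell_nonneg_of_bernAuto_trunc wtboxY slL17_nodup slL17_deg 4 71 502 (q := 16) (a := 9) (L := 9) (by norm_num) (by norm_num) (by norm_num) (by rw [phatboxYs4_eq]; exact cellChk_boxY_s4l1) (by norm_num; linarith) (by norm_num; linarith)
      rcases le_or_gt Δ ((59 : ℝ) / 8) with hd2 | hd2
      · exact cell_nonneg_of_bernAuto_trunc wtboxY slL17_nodup slL17_deg 4 71 502 (q := 16) (a := 18) (L := 9) (by norm_num) (by norm_num) (by norm_num) (by rw [phatboxYs4_eq]; exact cellChk_boxY_s4l2) (by norm_num; linarith) (by norm_num; linarith)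
      rcases le_or_gt Δ ((127 : ℝ) / 16) with hd3 | hd3
      · exact cell_nonneg_of_bernAuto_trunc wtboxY slL17_nodup slL17_deg 4 71 502 (q := 32) (a := 54) (L := 9) (by norm_num) (by norm_num) (by norm_num) (by rw [phatboxYs4_eq]; exact cellChk_boxY_s4l3) (by norm_num; linarith) (by norm_num; linarith)
      rcases le_or_gt Δ ((263 : ℝ) / 32) with hd4 | hd4
      · exact cell_nonneg_of_bernAuto_trunc wtboxY slL17_nodup slL17_deg 4 71 502 (q := 64) (a := 126) (L := 9) (by norm_num) (by norm_num) (by norm_num) (by rw [phatboxYs4_eq]; exact cellChk_boxY_s4l4) (by norm_num; linarith) (by norm_num; linarith)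
      rcases le_or_gt Δ ((17 : ℝ) / 2) with hd5 | hd5
      · exact cell_nonneg_of_bernAuto_trunc wtboxY slL17_nodup slL17_deg 4 71 502 (q := 64) (a := 135) (L := 9) (by norm_num) (by norm_num) (by norm_num) (by rw [phatboxYs4_eq, phatboxYs4_eq_g2]; exact cellChk_boxY_s4l5) (by norm_num; linarith) (by norm_num; linarith)
      rcases le_or_gt Δ (13 : ℝ) with hd6 | hd6
      · exact cell_nonneg_of_bernAuto_trunc wtboxY slL17_nodup slL17_deg 4 71 502 (q := 4) (a := 9) (L := 9) (by norm_num) (by norm_num) (by norm_num) (by rw [phatboxYs4_eq, phatboxYs4_eq_g2]; exact cellChk_boxY_s4l6) (by norm_num; linarith) (by norm_num; linarith)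
      rcases le_or_gt Δ (22 : ℝ) with hd7 | hd7
      · exact cell_nonneg_of_bernAuto_trunc wtboxY slL17_nodup slL17_deg 4 71 502 (q := 2) (a := 9) (L := 9) (by norm_num) (by norm_num) (by norm_num) (by rw [phatboxYs4_eq, phatboxYs4_eq_g2]; exact cellChk_boxY_s4l7) (by norm_num; linarith) (by norm_num; linarith)
      exact cell_nonneg_of_bernAuto_trunc wtboxY slL17_nodup slL17_deg 4 71 502 (q := 1) (a := 9) (L := 9) (by norm_num) (by norm_num) (by norm_num) (by rw [phatboxYs4_eq, phatboxYs4_eq_g2]; exact cellChk_boxY_s4l8) (by norm_num; linarith) (by norm_num; linarith)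
    · exact absurd hℓ (by decide)
    · have h1 : (6 : ℝ) ≤ Δ := by exact_mod_cast hℓΔ
      refine ⟨71 + 1, by norm_num, ?_⟩
      rcases le_or_gt Δ ((113 : ℝ) / 16) with hd0 | hd0
      · exact cell_nonneg_of_bernAuto_trunc wtboxY slL17_nodup slL17_deg 6 71 507 (q := 32) (a := 0) (L := 17) (by norm_num) (by norm_num) (by norm_num) (by rw [phatboxYs6_eq]; exact cellChk_boxY_s6l0) (by norm_num; linarith) (by norm_num; linarith)
      rcases le_or_gt Δ ((65 : ℝ) / 8) with hd1 | hd1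
      · exact cell_nonneg_of_bernAuto_trunc wtboxY slL17_nodup slL17_deg 6 71 507 (q := 32) (a := 17) (L := 17) (by norm_num) (by norm_num) (by norm_num) (by rw [phatboxYs6_eq]; exact cellChk_boxY_s6l1) (by norm_num; linarith) (by norm_num; linarith)
      rcases le_or_gt Δ ((41 : ℝ) / 4) with hd2 | hd2
      · exact cell_nonneg_of_bernAuto_trunc wtboxY slL17_nodup slL17_deg 6 71 507 (q := 16) (a := 17) (L := 17) (by norm_num) (by norm_num) (by norm_num) (by rw [phatboxYs6_eq]; exact cellChk_boxY_s6l2) (by norm_num; linarith) (by norm_num; linarith)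
      rcases le_or_gt Δ ((345 : ℝ) / 32) with hd3 | hd3
      · exact cell_nonneg_of_bernAuto_trunc wtboxY slL17_nodup slL17_deg 6 71 507 (q := 64) (a := 136) (L := 17) (by norm_num) (by norm_num) (by norm_num) (by rw [phatboxYs6_eq]; exact cellChk_boxY_s6l3) (by norm_num; linarith) (by norm_num; linarith)
      rcases le_or_gt Δ ((181 : ℝ) / 16) with hd4 | hd4
      · exact cell_nonneg_of_bernAuto_trunc wtboxY slL17_nodup slL17_deg 6 71 507 (q := 64) (a := 153) (L := 17) (by norm_num) (by norm_num) (by norm_num) (by rw [phatboxYs6_eq]; exact cellChk_boxY_s6l4) (by norm_num; linarith) (by norm_num; linarith)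
      rcases le_or_gt Δ ((99 : ℝ) / 8) with hd5 | hd5
      · exact cell_nonneg_of_bernAuto_trunc wtboxY slL17_nodup slL17_deg 6 71 507 (q := 32) (a := 85) (L := 17) (by norm_num) (by norm_num) (by norm_num) (by rw [phatboxYs6_eq, phatboxYs6_eq_g2]; exact cellChk_boxY_s6l5) (by norm_num; linarith) (by norm_num; linarith)
      rcases le_or_gt Δ ((29 : ℝ) / 2) with hd6 | hd6
      · exact cell_nonneg_of_bernAuto_trunc wtboxY slL17_nodup slL17_deg 6 71 507 (q := 16) (a := 51) (L := 17) (by norm_num) (by norm_num) (by norm_num) (by rw [phatboxYs6_eq, phatboxYs6_eq_g2]; exact cellChk_boxY_s6l6) (by norm_num; linarith) (by norm_num; linarith)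
      rcases le_or_gt Δ (23 : ℝ) with hd7 | hd7
      · exact cell_nonneg_of_bernAuto_trunc wtboxY slL17_nodup slL17_deg 6 71 507 (q := 4) (a := 17) (L := 17) (by norm_num) (by norm_num) (by norm_num) (by rw [phatboxYs6_eq, phatboxYs6_eq_g2]; exact cellChk_boxY_s6l7) (by norm_num; linarith) (by norm_num; linarith)
      exact cell_nonneg_of_bernAuto_trunc wtboxY slL17_nodup slL17_deg 6 71 507 (q := 2) (a := 17) (L := 17) (by norm_num) (by norm_num) (by norm_num) (by rw [phatboxYs6_eq, phatboxYs6_eq_g2]; exact cellChk_boxY_s6l8) (by norm_num; linarith) (by norm_num; linarith)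
    · exact absurd hℓ (by decide)
    · have h1 : (8 : ℝ) ≤ Δ := by exact_mod_cast hℓΔ
      refine ⟨71 + 1, by norm_num, ?_⟩
      rcases le_or_gt Δ (10 : ℝ) with hd0 | hd0
      · exact cell_nonneg_of_bernAuto_trunc wtboxY slL17_nodup slL17_deg 8 71 510 (q := 1) (a := 0) (L := 1) (by norm_num) (by norm_num) (by norm_num) (by rw [phatboxYs8_eq]; exact cellChk_boxY_s8l0) (by norm_num; linarith) (by norm_num; linarith)
      rcases le_or_gt Δ (12 : ℝ) with hd1 | hd1
      · exact cell_nonneg_of_bernAuto_trunc wtboxY slL17_nodup slL17_deg 8 71 510 (q := 1) (a := 1) (L := 1) (by norm_num) (by norm_num) (by norm_num) (by rw [phatboxYs8_eq]; exact cellChk_boxY_s8l1) (by norm_num; linarith) (by norm_num; linarith)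
      rcases le_or_gt Δ (16 : ℝ) with hd2 | hd2
      · exact cell_nonneg_of_bernAuto_trunc wtboxY slL17_nodup slL17_deg 8 71 510 (q := 1) (a := 2) (L := 2) (by norm_num) (by norm_num) (by norm_num) (by rw [phatboxYs8_eq]; exact cellChk_boxY_s8l2) (by norm_num; linarith) (by norm_num; linarith)
      rcases le_or_gt Δ (24 : ℝ) with hd3 | hd3
      · exact cell_nonneg_of_bernAuto_trunc wtboxY slL17_nodup slL17_deg 8 71 510 (q := 1) (a := 4) (L := 4) (by norm_num) (by norm_num) (by norm_num) (by rw [phatboxYs8_eq]; exact cellChk_boxY_s8l3) (by norm_num; linarith) (by norm_num; linarith)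
      exact cell_nonneg_of_bernAuto_trunc wtboxY slL17_nodup slL17_deg 8 71 510 (q := 1) (a := 8) (L := 8) (by norm_num) (by norm_num) (by norm_num) (by rw [phatboxYs8_eq]; exact cellChk_boxY_s8l4) (by norm_num; linarith) (by norm_num; linarith)
    · exact absurd hℓ (by decide)
    · have h1 : (10 : ℝ) ≤ Δ := by exact_mod_cast hℓΔ
      refine ⟨63 + 1, by norm_num, ?_⟩
      rcases le_or_gt Δ ((175 : ℝ) / 16) with hd0 | hd0
      · exact cell_nonneg_of_bernAuto_trunc wtboxY slL17_nodup slL17_deg 10 63 451 (q := 32) (a := 0) (L := 15) (by norm_num) (by norm_num) (by norm_num) (by rw [phatboxYs10_eq]; exact cellChk_boxY_s10l0) (by norm_num; linarith) (by norm_num; linarith)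
      rcases le_or_gt Δ ((95 : ℝ) / 8) with hd1 | hd1
      · exact cell_nonneg_of_bernAuto_trunc wtboxY slL17_nodup slL17_deg 10 63 451 (q := 32) (a := 15) (L := 15) (by norm_num) (by norm_num) (by norm_num) (by rw [phatboxYs10_eq]; exact cellChk_boxY_s10l1) (by norm_num; linarith) (by norm_num; linarith)
      rcases le_or_gt Δ ((55 : ℝ) / 4) with hd2 | hd2
      · exact cell_nonneg_of_bernAuto_trunc wtboxY slL17_nodup slL17_deg 10 63 451 (q := 16) (a := 15) (L := 15) (by norm_num) (by norm_num) (by norm_num) (by rw [phatboxYs10_eq]; exact cellChk_boxY_s10l2) (by norm_num; linarith) (by norm_num; linarith)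
      rcases le_or_gt Δ ((35 : ℝ) / 2) with hd3 | hd3
      · exact cell_nonneg_of_bernAuto_trunc wtboxY slL17_nodup slL17_deg 10 63 451 (q := 8) (a := 15) (L := 15) (by norm_num) (by norm_num) (by norm_num) (by rw [phatboxYs10_eq]; exact cellChk_boxY_s10l3) (by norm_num; linarith) (by norm_num; linarith)
      rcases le_or_gt Δ (25 : ℝ) with hd4 | hd4
      · exact cell_nonneg_of_bernAuto_trunc wtboxY slL17_nodup slL17_deg 10 63 451 (q := 4) (a := 15) (L := 15) (by norm_num) (by norm_num) (by norm_num) (by rw [phatboxYs10_eq]; exact cellChk_boxY_s10l4) (by norm_num; linarith) (by norm_num; linarith)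
      exact cell_nonneg_of_bernAuto_trunc wtboxY slL17_nodup slL17_deg 10 63 451 (q := 2) (a := 15) (L := 15) (by norm_num) (by norm_num) (by norm_num) (by rw [phatboxYs10_eq]; exact cellChk_boxY_s10l5) (by norm_num; linarith) (by norm_num; linarith)
    · exact absurd hℓ (by decide)
    · have h1 : (12 : ℝ) ≤ Δ := by exact_mod_cast hℓΔ
      refine ⟨63 + 1, by norm_num, ?_⟩
      exact cell_nonneg_of_bernAuto_trunc wtboxY slL17_nodup slL17_deg 12 63 455 (q := 1) (a := 0) (L := 14) (by norm_num) (by norm_num) (by norm_num) (by rw [phatboxYs12_eq]; exact cellChk_boxY_s12l0) (by norm_num; linarith) (by norm_num; linarith)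
    · exact absurd hℓ (by decide)
    · have h1 : (14 : ℝ) ≤ Δ := by exact_mod_cast hℓΔ
      refine ⟨63 + 1, by norm_num, ?_⟩
      exact cell_nonneg_of_bernAuto_trunc wtboxY slL17_nodup slL17_deg 14 63 459 (q := 1) (a := 0) (L := 13) (by norm_num) (by norm_num) (by norm_num) (by rw [phatboxYs14_eq]; exact cellChk_boxY_s14l0) (by norm_num; linarith) (by norm_num; linarith)
    · exact absurd hℓ (by decide)
    · have h1 : (16 : ℝ) ≤ Δ := by exact_mod_cast hℓΔ
      refine ⟨55 + 1, by norm_num, ?_⟩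
      exact cell_nonneg_of_bernAuto_trunc wtboxY slL17_nodup slL17_deg 16 55 399 (q := 1) (a := 0) (L := 12) (by norm_num) (by norm_num) (by norm_num) (by rw [phatboxYs16_eq]; exact cellChk_boxY_s16l0) (by norm_num; linarith) (by norm_num; linarith)
    · exact absurd hℓ (by decide)
    · have h1 : (18 : ℝ) ≤ Δ := by exact_mod_cast hℓΔ
      refine ⟨47 + 1, by norm_num, ?_⟩
      exact cell_nonneg_of_bernAuto_trunc wtboxY slL17_nodup slL17_deg 18 47 340 (q := 1) (a := 0) (L := 11) (by norm_num) (by norm_num) (by norm_num) (by rw [phatboxYs18_eq]; exact cellChk_boxY_s18l0) (by norm_num; linarith) (by norm_num; linarith)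
    · exact absurd hℓ (by decide)
    · have h1 : (20 : ℝ) ≤ Δ := by exact_mod_cast hℓΔ
      refine ⟨47 + 1, by norm_num, ?_⟩
      exact cell_nonneg_of_bernAuto_trunc wtboxY slL17_nodup slL17_deg 20 47 342 (q := 1) (a := 0) (L := 10) (by norm_num) (by norm_num) (by norm_num) (by rw [phatboxYs20_eq]; exact cellChk_boxY_s20l0) (by norm_num; linarith) (by norm_num; linarith)
    · exact absurd hℓ (by decide)
    · have h1 : (22 : ℝ) ≤ Δ := by exact_mod_cast hℓΔ
      refine ⟨47 + 1, by norm_num, ?_⟩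
      exact cell_nonneg_of_bernAuto_trunc wtboxY slL17_nodup slL17_deg 22 47 345 (q := 1) (a := 0) (L := 9) (by norm_num) (by norm_num) (by norm_num) (by rw [phatboxYs22_eq]; exact cellChk_boxY_s22l0) (by norm_num; linarith) (by norm_num; linarith)
    · exact absurd hℓ (by decide)
    · have h1 : (24 : ℝ) ≤ Δ := by exact_mod_cast hℓΔ
      refine ⟨47 + 1, by norm_num, ?_⟩
      exact cell_nonneg_of_bernAuto_trunc wtboxY slL17_nodup slL17_deg 24 47 347 (q := 1) (a := 0) (L := 8) (by norm_num) (by norm_num) (by norm_num) (by rw [phatboxYs24_eq]; exact cellChk_boxY_s24l0) (by norm_num; linarith) (by norm_num; linarith)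
    · exact absurd hℓ (by decide)
    · have h1 : (26 : ℝ) ≤ Δ := by exact_mod_cast hℓΔ
      refine ⟨47 + 1, by norm_num, ?_⟩
      exact cell_nonneg_of_bernAuto_trunc wtboxY slL17_nodup slL17_deg 26 47 349 (q := 1) (a := 0) (L := 7) (by norm_num) (by norm_num) (by norm_num) (by rw [phatboxYs26_eq]; exact cellChk_boxY_s26l0) (by norm_num; linarith) (by norm_num; linarith)
    · exact absurd hℓ (by decide)
    · have h1 : (28 : ℝ) ≤ Δ := by exact_mod_cast hℓΔ
      refine ⟨47 + 1, by norm_num, ?_⟩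
      exact cell_nonneg_of_bernAuto_trunc wtboxY slL17_nodup slL17_deg 28 47 351 (q := 1) (a := 0) (L := 6) (by norm_num) (by norm_num) (by norm_num) (by rw [phatboxYs28_eq]; exact cellChk_boxY_s28l0) (by norm_num; linarith) (by norm_num; linarith)
    · exact absurd hℓ (by decide)
    · have h1 : (30 : ℝ) ≤ Δ := by exact_mod_cast hℓΔ
      refine ⟨47 + 1, by norm_num, ?_⟩
      exact cell_nonneg_of_bernAuto_trunc wtboxY slL17_nodup slL17_deg 30 47 352 (q := 1) (a := 0) (L := 5) (by norm_num) (by norm_num) (by norm_num) (by rw [phatboxYs30_eq]; exact cellChk_boxY_s30l0) (by norm_num; linarith) (by norm_num; linarith)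
    · exact absurd hℓ (by decide)
    · have h1 : (32 : ℝ) ≤ Δ := by exact_mod_cast hℓΔ
      refine ⟨47 + 1, by norm_num, ?_⟩
      exact cell_nonneg_of_bernAuto_trunc wtboxY slL17_nodup slL17_deg 32 47 354 (q := 1) (a := 0) (L := 4) (by norm_num) (by norm_num) (by norm_num) (by rw [phatboxYs32_eq]; exact cellChk_boxY_s32l0) (by norm_num; linarith) (by norm_num; linarith)
    · exact absurd hℓ (by decide)
    · have h1 : (34 : ℝ) ≤ Δ := by exact_mod_cast hℓΔ
      refine ⟨47 + 1, by norm_num, ?_⟩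
      exact cell_nonneg_of_bernAuto_trunc wtboxY slL17_nodup slL17_deg 34 47 356 (q := 1) (a := 0) (L := 3) (by norm_num) (by norm_num) (by norm_num) (by rw [phatboxYs34_eq]; exact cellChk_boxY_s34l0) (by norm_num; linarith) (by norm_num; linarith)
    · exact absurd hℓ (by decide)
    · have h1 : (36 : ℝ) ≤ Δ := by exact_mod_cast hℓΔ
      refine ⟨47 + 1, by norm_num, ?_⟩
      exact cell_nonneg_of_bernAuto_trunc wtboxY slL17_nodup slL17_deg 36 47 357 (q := 1) (a := 0) (L := 2) (by norm_num) (by norm_num) (by norm_num) (by rw [phatboxYs36_eq]; exact cellChk_boxY_s36l0) (by norm_num; linarith) (by norm_num; linarith)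
    · exact absurd hℓ (by decide)
    · have h1 : (38 : ℝ) ≤ Δ := by exact_mod_cast hℓΔ
      refine ⟨47 + 1, by norm_num, ?_⟩
      exact cell_nonneg_of_bernAuto_trunc wtboxY slL17_nodup slL17_deg 38 47 359 (q := 1) (a := 0) (L := 1) (by norm_num) (by norm_num) (by norm_num) (by rw [phatboxYs38_eq]; exact cellChk_boxY_s38l0) (by norm_num; linarith) (by norm_num; linarith)
    · exact absurd hℓ (by decide)

/-- **2D control, γ-architecture, kind `box`, kernel-complete: under `A2D′` at `Δ_σ = 1/8` no `ε` location in
`[977/1000, 491/500]` is possible**, every obligation of the Λ = 17 functional checked in the Lean kernel. CONTROL-ONLY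
(d = 2). [cite: RattazziEtAl2008, §5.5] -/
theorem excludedOn_2d_L17_boxY : ExcludedOn (1 / 8 : ℝ) 2 1 (Icc (977 / 1000 : ℝ) (491 / 500)) :=
  excludedOn_half_of_cellsN slL17.toFinset (fun p => (wtboxY p : ℝ)) (by norm_num) (by norm_num) (by norm_num)
    (by norm_num) (by norm_num) ident_boxY (region_of_kernelCertAuto wtboxY slL17_nodup slL17_deg 17 18 (by norm_num) (by norm_num) PregboxY_eq
      (by decide +kernel) QhatboxY_eq _ cregboxY_n0 cregJboxY (by decide) cregJboxY_ok) cells_boxY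

/-- **The same as a `BoxExcluded` statement** (the box lies above `2Δ_σ = 1/4`). [cite: RattazziEtAl2008, §5.5] -/
theorem boxExcluded_2d_L17_boxY : BoxExcluded (1 / 8 : ℝ) 2 1 (977 / 1000) (491 / 500) :=
  boxExcluded_half_of_cellsN slL17.toFinset (fun p => (wtboxY p : ℝ)) (by norm_num) (by norm_num) (by norm_num)
    (by norm_num) (by norm_num) (by norm_num) ident_boxY (region_of_kernelCertAuto wtboxY slL17_nodup slL17_deg 17 18 (by norm_num) (by norm_num) PregboxY_eq
      (by decide +kernel) QhatboxY_eq _ cregboxY_n0 cregJboxY (by decide) cregJboxY_ok) cells_boxY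

end Summit.CriticalPhenomena.Ising3D.Control2D
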